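import Summits.Ventures.PercRepro.RankLevelSetBiIndepContainSkewPaving
import Summits.Ventures.PercRepro.RankLevelSetIndepCDModel

/-! # RankLevelSetBiIndepContainSkewUniform — UNIFORM MATROIDS ARE PAVING, HENCE SATISFY (CX*) AND (CX)
(night-1 g29; g28's successor order (3))

The uniform matroid `U_{p,E} = modelMatroid hE ∅ q p` (independent = `X ⊆ E` with `#X ≤ p`) has rank `≤ p`
(`uniform_eRank_le`), so every subset with fewer than `rank` elements is independent: **`uniform_paving`**. With
`biContainSkew_of_paving` / `biContainMono_of_paving` (g28): **`biContainSkew_uniform`** and **`biContainMono_uniform`**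
— the contain-`X` skewness (CX*) `α^X_k ≤ α^X_{#E−1−k}` (`2k + 1 < #E`) and the contain-`X` monotonicity (CX)
`α^X_k ≤ α^X_{k+1}` (`2(k+1) ≤ #E`) hold for EVERY uniform matroid and EVERY contain-set `X`. Every declaration has a
docstring; imports: the cell's own modules and Mathlib only. Axioms: standard. -/

namespace PercRepro

open Set Matroid

variable {α : Type}

/-- The rank of the uniform matroid `U_{p,E}` is at most `p`. -/
lemma uniform_eRank_le {E : Set α} (hE : E.Finite) (q p : ℕ) : (modelMatroid hE ∅ q p).eRank ≤ p := by
  rw [Matroid.eRank_def, Matroid.eRk_le_iff]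
  intro I _ hI
  obtain ⟨hIE, hIp⟩ := (uniform_indep_iff hE q p I).mp hI
  rw [← (hE.subset hIE).cast_ncard_eq]
  exact_mod_cast hIp

/-- **Uniform matroids are paving.** -/
theorem uniform_paving {E : Set α} (hE : E.Finite) (q p : ℕ) : Paving (modelMatroid hE ∅ q p) := by
  intro I hI hlt
  rw [modelMatroid_E] at hI
  have hfin : I.Finite := hE.subset hI
  have h1 : I.encard < p := lt_of_lt_of_le hlt (uniform_eRank_le hE q p)
  rw [← hfin.cast_ncard_eq] at h1
  exact (uniform_indep_iff hE q p I).mpr ⟨hI, le_of_lt (by exact_mod_cast h1)⟩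

/-- **(CX*) FOR EVERY UNIFORM MATROID**: `BiContainSkew (modelMatroid hE ∅ q p)`. -/
theorem biContainSkew_uniform {E : Set α} (hE : E.Finite) (q p : ℕ) :
    haveI := modelMatroid_finite hE ∅ q p
    BiContainSkew (modelMatroid hE ∅ q p) :=
  haveI := modelMatroid_finite hE ∅ q p
  biContainSkew_of_paving _ (uniform_paving hE q p)

/-- **(CX) FOR EVERY UNIFORM MATROID**: `BiContainMono (modelMatroid hE ∅ q p)`. -/
theorem biContainMono_uniform {E : Set α} (hE : E.Finite) (q p : ℕ) :
    haveI := modelMatroid_finite hE ∅ q p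
    BiContainMono (modelMatroid hE ∅ q p) :=
  haveI := modelMatroid_finite hE ∅ q p
  biContainMono_of_paving _ (uniform_paving hE q p)

end PercRepro
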